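import Mathlib
import HarnessLib
import Summits.ValiantsHypothesis.ValiantsHypothesis.Theorems.LacunarySymmetroidMatrixDescartesOsculationLawGPArcResultant
import Summits.ValiantsHypothesis.ValiantsHypothesis.Theorems.LacunarySymmetroidMatrixDescartesOsculationLawGPLogHessianMul
import Summits.ValiantsHypothesis.ValiantsHypothesis.Theorems.LacunarySymmetroidMatrixDescartesOsculationLawRankOneCurve

/-!
# ValiantsHypothesis / LacunarySymmetroid — crux `MatrixDescartes` (stmt-ValiantsHypothesis-18050, V1),
# line `Cruxes/MatrixDescartes/Lines/osculation_law.lean` («osculation-law»), stub `stub_recursion`, general position (ROUTE′):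
# RANK-ONE SHEETS ON THE ARC — the arc-avoidance certificate for product (diagonal) witness curves (NOTE-p7g13 §3, §9; bus m022/m023)

The node curves of a DIAGONAL witness pencil are products `Φ = Π_i L_i` of rank-one SHEETS `L_i = α_i·X₁ + ι(g_i)` (`α_i ∈ ℝ`,
`g_i ∈ ℝ[t]`, `ι : t ↦ X₀`).  For such curves the arc-avoidance certificate of `…GPArcResultant`
(«`Φ(t, C·t^N)` and `H(Φ)(t, C·t^N)` coprime») reduces to ONE-VARIABLE coprimality statements about the sheets:

* (chain rule for `Polynomial.aeval (X 0)`: `OsculationRankOne.pderiv_zero_aevalX0` / `pderiv_one_aevalX0`, cited.)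
* `logHessian_sheet` — `H(α·X₁ + ι g) = C α·X₁·(C α·X₁·ι(θ²g) + ι(θg)²)`, `θ = t·d/dt`.
* `arc_sheet`, `arc_logHessian_sheet` — restrictions to the arc `b = C·t^N`: `f := C(αC)·X^N + g` and
  `C(αC)·X^N·(C(αC)·X^N·θ²g + (θg)²)`.
* **`isCoprime_arc_logHessian_prod`** — if the restricted sheets `f_i` are pairwise coprime and each `f_i` is coprime to its own
  restricted log-Hessian, then `Φ_arc = Π f_i` is coprime to `H(Φ)_arc` (product rule `dvd_logHessian_mul_sub`: modulo a sheet, the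
  log-Hessian of the product is `M³` times that of the sheet).

Honest framing: algebraic LEMMAS toward the OPEN stub `stub_recursion` (its density residue); nothing of the summit is proved;
`VP ≠ VNP` is NOT proved.  No definitions, no named facts.
-/

-- `Summit.ValiantsHypothesis.ValiantsHypothesis.…` is the tree's mandated single-conjunct layout (Sub = Summit).
set_option linter.dupNamespace false

noncomputable section

namespace Summit.ValiantsHypothesis.ValiantsHypothesis.Theorems.LacunarySymmetroidMatrixDescartes

open Polynomial

namespace OsculationGeneric

/-! ### Calculus of a sheet `α·X₁ + ι(g)` -/

/-- **The bordered log-Hessian of a sheet** `L = C α·X₁ + ι(g)`: `H(L) = C α·X₁·(C α·X₁·ι(X·(X·g′)′) + ι(X·g′)²)`. [folklore] -/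
theorem logHessian_sheet (α : ℝ) (g : ℝ[X]) :
    (MvPolynomial.X 0 * MvPolynomial.pderiv 0 (MvPolynomial.X 0 * MvPolynomial.pderiv 0 (MvPolynomial.C α * MvPolynomial.X 1 + Polynomial.aeval (MvPolynomial.X 0 : MvPolynomial (Fin 2) ℝ) g))
            * (MvPolynomial.X 1 * MvPolynomial.pderiv 1 (MvPolynomial.C α * MvPolynomial.X 1 + Polynomial.aeval (MvPolynomial.X 0 : MvPolynomial (Fin 2) ℝ) g)) ^ 2
          - 2 * (MvPolynomial.X 0 * MvPolynomial.pderiv 0 (MvPolynomial.X 1 * MvPolynomial.pderiv 1 (MvPolynomial.C α * MvPolynomial.X 1 + Polynomial.aeval (MvPolynomial.X 0 : MvPolynomial (Fin 2) ℝ) g)))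
            * (MvPolynomial.X 0 * MvPolynomial.pderiv 0 (MvPolynomial.C α * MvPolynomial.X 1 + Polynomial.aeval (MvPolynomial.X 0 : MvPolynomial (Fin 2) ℝ) g)) * (MvPolynomial.X 1 * MvPolynomial.pderiv 1 (MvPolynomial.C α * MvPolynomial.X 1 + Polynomial.aeval (MvPolynomial.X 0 : MvPolynomial (Fin 2) ℝ) g))
          + MvPolynomial.X 1 * MvPolynomial.pderiv 1 (MvPolynomial.X 1 * MvPolynomial.pderiv 1 (MvPolynomial.C α * MvPolynomial.X 1 + Polynomial.aeval (MvPolynomial.X 0 : MvPolynomial (Fin 2) ℝ) g))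
            * (MvPolynomial.X 0 * MvPolynomial.pderiv 0 (MvPolynomial.C α * MvPolynomial.X 1 + Polynomial.aeval (MvPolynomial.X 0 : MvPolynomial (Fin 2) ℝ) g)) ^ 2) =
      MvPolynomial.C α * MvPolynomial.X 1 *
        (MvPolynomial.C α * MvPolynomial.X 1 *
            Polynomial.aeval (MvPolynomial.X 0 : MvPolynomial (Fin 2) ℝ) (X * derivative (X * derivative g))
          + (Polynomial.aeval (MvPolynomial.X 0 : MvPolynomial (Fin 2) ℝ) (X * derivative g)) ^ 2) := by
  have h0 : MvPolynomial.pderiv 0 (MvPolynomial.C α * MvPolynomial.X 1 +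
      Polynomial.aeval (MvPolynomial.X 0 : MvPolynomial (Fin 2) ℝ) g) =
      Polynomial.aeval (MvPolynomial.X 0 : MvPolynomial (Fin 2) ℝ) (derivative g) := by
    rw [map_add, MvPolynomial.pderiv_C_mul, MvPolynomial.pderiv_X_of_ne (by decide : (1 : Fin 2) ≠ 0), mul_zero, zero_add,
      OsculationRankOne.pderiv_zero_aevalX0]
  have h1 : MvPolynomial.pderiv 1 (MvPolynomial.C α * MvPolynomial.X 1 +
      Polynomial.aeval (MvPolynomial.X 0 : MvPolynomial (Fin 2) ℝ) g) = MvPolynomial.C α := by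
    rw [map_add, MvPolynomial.pderiv_C_mul, MvPolynomial.pderiv_X_self, mul_one, OsculationRankOne.pderiv_one_aevalX0, add_zero]
  -- the Euler derivatives
  have hθg : ∀ q : ℝ[X], MvPolynomial.X 0 * Polynomial.aeval (MvPolynomial.X 0 : MvPolynomial (Fin 2) ℝ) (derivative q) =
      Polynomial.aeval (MvPolynomial.X 0 : MvPolynomial (Fin 2) ℝ) (X * derivative q) := fun q => by
    rw [map_mul, aeval_X]
  have e0 : MvPolynomial.X 0 * MvPolynomial.pderiv 0 (MvPolynomial.C α * MvPolynomial.X 1 +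
      Polynomial.aeval (MvPolynomial.X 0 : MvPolynomial (Fin 2) ℝ) g) =
      Polynomial.aeval (MvPolynomial.X 0 : MvPolynomial (Fin 2) ℝ) (X * derivative g) := by rw [h0, hθg]
  have e1 : MvPolynomial.X 1 * MvPolynomial.pderiv 1 (MvPolynomial.C α * MvPolynomial.X 1 +
      Polynomial.aeval (MvPolynomial.X 0 : MvPolynomial (Fin 2) ℝ) g) = MvPolynomial.C α * MvPolynomial.X 1 := by
    rw [h1, mul_comm]
  have e00 : MvPolynomial.X 0 * MvPolynomial.pderiv 0 (Polynomial.aeval (MvPolynomial.X 0 : MvPolynomial (Fin 2) ℝ)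
      (X * derivative g)) = Polynomial.aeval (MvPolynomial.X 0 : MvPolynomial (Fin 2) ℝ) (X * derivative (X * derivative g)) := by
    rw [OsculationRankOne.pderiv_zero_aevalX0, hθg]
  have e01 : MvPolynomial.X 0 * MvPolynomial.pderiv 0 (MvPolynomial.C α * MvPolynomial.X 1 : MvPolynomial (Fin 2) ℝ) = 0 := by
    rw [MvPolynomial.pderiv_C_mul, MvPolynomial.pderiv_X_of_ne (by decide : (1 : Fin 2) ≠ 0), mul_zero, mul_zero]
  have e11 : MvPolynomial.X 1 * MvPolynomial.pderiv 1 (MvPolynomial.C α * MvPolynomial.X 1 : MvPolynomial (Fin 2) ℝ) =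
      MvPolynomial.C α * MvPolynomial.X 1 := by
    rw [MvPolynomial.pderiv_C_mul, MvPolynomial.pderiv_X_self, mul_one, mul_comm]
  rw [e0, e1, e00, e01, e11]
  ring

/-- The sheet restricted to the arc `b = C·t^N`: `f = C(α·C)·X^N + g`. [folklore] -/
theorem arc_aeval_X (C : ℝ) (N : ℕ) (q : ℝ[X]) :
    MvPolynomial.aeval (![Polynomial.X, Polynomial.C C * Polynomial.X ^ N] : Fin 2 → ℝ[X])
        (Polynomial.aeval (MvPolynomial.X 0 : MvPolynomial (Fin 2) ℝ) q) = q := by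
  rw [← Polynomial.aeval_algHom_apply, MvPolynomial.aeval_X]
  simp

/-- The sheet restricted to the arc `b = C·t^N`: `f = C(α·C)·X^N + g`. [folklore] -/
theorem arc_sheet (α C : ℝ) (N : ℕ) (g : ℝ[X]) :
    MvPolynomial.aeval (![Polynomial.X, Polynomial.C C * Polynomial.X ^ N] : Fin 2 → ℝ[X])
        (MvPolynomial.C α * MvPolynomial.X 1 + Polynomial.aeval (MvPolynomial.X 0 : MvPolynomial (Fin 2) ℝ) g) =
      Polynomial.C (α * C) * X ^ N + g := by
  rw [map_add, arc_aeval_X, map_mul, MvPolynomial.aeval_C, MvPolynomial.aeval_X, Polynomial.algebraMap_eq]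
  simp only [Matrix.cons_val_one, Matrix.cons_val_zero, map_mul]
  ring

/-- The sheet's log-Hessian restricted to the arc: `C(αC)X^N·(C(αC)X^N·θ²g + (θg)²)`. [folklore] -/
theorem arc_logHessian_sheet (α C : ℝ) (N : ℕ) (g : ℝ[X]) :
    MvPolynomial.aeval (![Polynomial.X, Polynomial.C C * Polynomial.X ^ N] : Fin 2 → ℝ[X])
        (MvPolynomial.X 0 * MvPolynomial.pderiv 0 (MvPolynomial.X 0 * MvPolynomial.pderiv 0 (MvPolynomial.C α * MvPolynomial.X 1 + Polynomial.aeval (MvPolynomial.X 0 : MvPolynomial (Fin 2) ℝ) g))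
            * (MvPolynomial.X 1 * MvPolynomial.pderiv 1 (MvPolynomial.C α * MvPolynomial.X 1 + Polynomial.aeval (MvPolynomial.X 0 : MvPolynomial (Fin 2) ℝ) g)) ^ 2
          - 2 * (MvPolynomial.X 0 * MvPolynomial.pderiv 0 (MvPolynomial.X 1 * MvPolynomial.pderiv 1 (MvPolynomial.C α * MvPolynomial.X 1 + Polynomial.aeval (MvPolynomial.X 0 : MvPolynomial (Fin 2) ℝ) g)))
            * (MvPolynomial.X 0 * MvPolynomial.pderiv 0 (MvPolynomial.C α * MvPolynomial.X 1 + Polynomial.aeval (MvPolynomial.X 0 : MvPolynomial (Fin 2) ℝ) g)) * (MvPolynomial.X 1 * MvPolynomial.pderiv 1 (MvPolynomial.C α * MvPolynomial.X 1 + Polynomial.aeval (MvPolynomial.X 0 : MvPolynomial (Fin 2) ℝ) g))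
          + MvPolynomial.X 1 * MvPolynomial.pderiv 1 (MvPolynomial.X 1 * MvPolynomial.pderiv 1 (MvPolynomial.C α * MvPolynomial.X 1 + Polynomial.aeval (MvPolynomial.X 0 : MvPolynomial (Fin 2) ℝ) g))
            * (MvPolynomial.X 0 * MvPolynomial.pderiv 0 (MvPolynomial.C α * MvPolynomial.X 1 + Polynomial.aeval (MvPolynomial.X 0 : MvPolynomial (Fin 2) ℝ) g)) ^ 2) =
      Polynomial.C (α * C) * X ^ N *
        (Polynomial.C (α * C) * X ^ N * (X * derivative (X * derivative g)) + (X * derivative g) ^ 2) := by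
  rw [logHessian_sheet]
  simp only [map_mul, map_add, map_pow, arc_aeval_X, MvPolynomial.aeval_C, MvPolynomial.aeval_X, Polynomial.algebraMap_eq,
    Matrix.cons_val_one, Matrix.cons_val_zero]
  ring

/-! ### Products of sheets: coprimality on the arc -/

/-- **Coprimality on the arc for a product.**  If the restrictions to the arc `b = C·t^N` of the factors `L i` are pairwise
coprime, and each is coprime to the restriction of its own bordered log-Hessian, then the restriction of the product is coprime to
the restriction of the log-Hessian of the product (`dvd_logHessian_mul_sub`: modulo a factor, `H(product) ≡ M³·H(factor)`).
[folklore] -/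
theorem isCoprime_arc_logHessian_prod {ι : Type*} [DecidableEq ι] (s : Finset ι) (L : ι → MvPolynomial (Fin 2) ℝ)
    (C : ℝ) (N : ℕ)
    (hpair : ∀ i ∈ s, ∀ j ∈ s, i ≠ j → IsCoprime ((MvPolynomial.aeval (![Polynomial.X, Polynomial.C C * Polynomial.X ^ N] : Fin 2 → ℝ[X])) (L i)) ((MvPolynomial.aeval (![Polynomial.X, Polynomial.C C * Polynomial.X ^ N] : Fin 2 → ℝ[X])) (L j)))
    (hself : ∀ i ∈ s, IsCoprime ((MvPolynomial.aeval (![Polynomial.X, Polynomial.C C * Polynomial.X ^ N] : Fin 2 → ℝ[X])) (L i))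
      ((MvPolynomial.aeval (![Polynomial.X, Polynomial.C C * Polynomial.X ^ N] : Fin 2 → ℝ[X]))
        (MvPolynomial.X 0 * MvPolynomial.pderiv 0 (MvPolynomial.X 0 * MvPolynomial.pderiv 0 (L i))
            * (MvPolynomial.X 1 * MvPolynomial.pderiv 1 (L i)) ^ 2
          - 2 * (MvPolynomial.X 0 * MvPolynomial.pderiv 0 (MvPolynomial.X 1 * MvPolynomial.pderiv 1 (L i)))
            * (MvPolynomial.X 0 * MvPolynomial.pderiv 0 (L i)) * (MvPolynomial.X 1 * MvPolynomial.pderiv 1 (L i))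
          + MvPolynomial.X 1 * MvPolynomial.pderiv 1 (MvPolynomial.X 1 * MvPolynomial.pderiv 1 (L i))
            * (MvPolynomial.X 0 * MvPolynomial.pderiv 0 (L i)) ^ 2))) :
    IsCoprime ((MvPolynomial.aeval (![Polynomial.X, Polynomial.C C * Polynomial.X ^ N] : Fin 2 → ℝ[X])) (∏ i ∈ s, L i))
      ((MvPolynomial.aeval (![Polynomial.X, Polynomial.C C * Polynomial.X ^ N] : Fin 2 → ℝ[X]))
        (MvPolynomial.X 0 * MvPolynomial.pderiv 0 (MvPolynomial.X 0 * MvPolynomial.pderiv 0 (∏ i ∈ s, L i))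
            * (MvPolynomial.X 1 * MvPolynomial.pderiv 1 (∏ i ∈ s, L i)) ^ 2
          - 2 * (MvPolynomial.X 0 * MvPolynomial.pderiv 0 (MvPolynomial.X 1 * MvPolynomial.pderiv 1 (∏ i ∈ s, L i)))
            * (MvPolynomial.X 0 * MvPolynomial.pderiv 0 (∏ i ∈ s, L i)) * (MvPolynomial.X 1 * MvPolynomial.pderiv 1 (∏ i ∈ s, L i))
          + MvPolynomial.X 1 * MvPolynomial.pderiv 1 (MvPolynomial.X 1 * MvPolynomial.pderiv 1 (∏ i ∈ s, L i))
            * (MvPolynomial.X 0 * MvPolynomial.pderiv 0 (∏ i ∈ s, L i)) ^ 2)) := by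
  rw [map_prod]
  refine IsCoprime.prod_left fun i hi => ?_
  -- split off the factor `L i`
  have hprod : ∏ j ∈ s, L j = L i * ∏ j ∈ s.erase i, L j := (Finset.mul_prod_erase s L hi).symm
  have hdvd := dvd_logHessian_mul_sub (L i) (∏ j ∈ s.erase i, L j)
  rw [← hprod] at hdvd
  obtain ⟨w, hw⟩ := hdvd
  have hM : IsCoprime ((MvPolynomial.aeval (![Polynomial.X, Polynomial.C C * Polynomial.X ^ N] : Fin 2 → ℝ[X])) (L i))
      ((MvPolynomial.aeval (![Polynomial.X, Polynomial.C C * Polynomial.X ^ N] : Fin 2 → ℝ[X])) (∏ j ∈ s.erase i, L j)) := by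
    rw [map_prod]
    exact IsCoprime.prod_right fun j hj => hpair i hi j (Finset.mem_of_mem_erase hj) (Finset.ne_of_mem_erase hj).symm
  have hkey : (MvPolynomial.aeval (![Polynomial.X, Polynomial.C C * Polynomial.X ^ N] : Fin 2 → ℝ[X]))
        (MvPolynomial.X 0 * MvPolynomial.pderiv 0 (MvPolynomial.X 0 * MvPolynomial.pderiv 0 (∏ i ∈ s, L i))
            * (MvPolynomial.X 1 * MvPolynomial.pderiv 1 (∏ i ∈ s, L i)) ^ 2
          - 2 * (MvPolynomial.X 0 * MvPolynomial.pderiv 0 (MvPolynomial.X 1 * MvPolynomial.pderiv 1 (∏ i ∈ s, L i)))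
            * (MvPolynomial.X 0 * MvPolynomial.pderiv 0 (∏ i ∈ s, L i)) * (MvPolynomial.X 1 * MvPolynomial.pderiv 1 (∏ i ∈ s, L i))
          + MvPolynomial.X 1 * MvPolynomial.pderiv 1 (MvPolynomial.X 1 * MvPolynomial.pderiv 1 (∏ i ∈ s, L i))
            * (MvPolynomial.X 0 * MvPolynomial.pderiv 0 (∏ i ∈ s, L i)) ^ 2) =
      (MvPolynomial.aeval (![Polynomial.X, Polynomial.C C * Polynomial.X ^ N] : Fin 2 → ℝ[X])) (∏ j ∈ s.erase i, L j) ^ 3 *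
        (MvPolynomial.aeval (![Polynomial.X, Polynomial.C C * Polynomial.X ^ N] : Fin 2 → ℝ[X]))
          (MvPolynomial.X 0 * MvPolynomial.pderiv 0 (MvPolynomial.X 0 * MvPolynomial.pderiv 0 (L i))
            * (MvPolynomial.X 1 * MvPolynomial.pderiv 1 (L i)) ^ 2
          - 2 * (MvPolynomial.X 0 * MvPolynomial.pderiv 0 (MvPolynomial.X 1 * MvPolynomial.pderiv 1 (L i)))
            * (MvPolynomial.X 0 * MvPolynomial.pderiv 0 (L i)) * (MvPolynomial.X 1 * MvPolynomial.pderiv 1 (L i))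
          + MvPolynomial.X 1 * MvPolynomial.pderiv 1 (MvPolynomial.X 1 * MvPolynomial.pderiv 1 (L i))
            * (MvPolynomial.X 0 * MvPolynomial.pderiv 0 (L i)) ^ 2) +
      (MvPolynomial.aeval (![Polynomial.X, Polynomial.C C * Polynomial.X ^ N] : Fin 2 → ℝ[X])) (L i) * (MvPolynomial.aeval (![Polynomial.X, Polynomial.C C * Polynomial.X ^ N] : Fin 2 → ℝ[X])) w := by
    rw [← map_pow, ← map_mul, ← map_mul, ← map_add, ← hw]
    ring_nf
  rw [hkey]
  exact ((hM.pow_right.mul_right (hself i hi))).add_mul_left_right _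

/-! ### Finitely many bad shifts for one sheet -/

/-- **Finitely many bad shifts.**  For real polynomials `g, W` with `W ≠ 0` and `W(0) ≠ 0`, the polynomial `C a·X^N + g` is
coprime to `W` for all but finitely many real `a`: a bad `a` is `−g(τ)/τ^N` for one of the finitely many (complex, nonzero)
roots `τ` of `W`. [folklore] -/
theorem finite_setOf_not_isCoprime_C_mul_X_pow_add (g W : ℝ[X]) (N : ℕ) (hW : W ≠ 0) (hW0 : W.eval 0 ≠ 0) :
    {a : ℝ | ¬ IsCoprime (Polynomial.C a * X ^ N + g) W}.Finite := by
  classical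
  -- the finitely many complex roots of `W`, and the candidate bad values they produce
  set B : Set ℂ := (fun z : ℂ => -(aeval z g) / z ^ N) '' (W.rootSet ℂ) with hB
  have hBfin : B.Finite := (W.rootSet_finite ℂ).image _
  refine (hBfin.preimage (Complex.ofReal_injective.injOn)).subset fun a ha => ?_
  -- a bad `a`: a common complex root `z` of `C a X^N + g` and `W`
  have ha' := mt (Polynomial.isCoprime_iff_aeval_ne_zero_of_isAlgClosed (k := ℝ) (K := ℂ)
    (p := Polynomial.C a * X ^ N + g) (q := W)).2 ha
  push Not at ha'
  obtain ⟨z, hz1, hz2⟩ := ha'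
  have hzroot : z ∈ W.rootSet ℂ := by
    rw [mem_rootSet]
    exact ⟨hW, hz2⟩
  have hz0 : z ≠ 0 := by
    rintro rfl
    have h := hz2
    rw [aeval_def, eval₂_at_zero, Complex.coe_algebraMap, Complex.ofReal_eq_zero, coeff_zero_eq_eval_zero] at h
    exact hW0 h
  refine ⟨z, hzroot, ?_⟩
  -- `a = -g(z)/z^N`
  have h1 : (a : ℂ) * z ^ N + aeval z g = 0 := by
    have h := hz1
    rwa [map_add, map_mul, aeval_C, map_pow, aeval_X, Complex.coe_algebraMap] at h
  show -(aeval z g) / z ^ N = (a : ℂ)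
  rw [div_eq_iff (pow_ne_zero _ hz0)]
  linear_combination -h1

end OsculationGeneric

end Summit.ValiantsHypothesis.ValiantsHypothesis.Theorems.LacunarySymmetroidMatrixDescartes

end
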